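import Summits.RiemannHypothesis.RiemannHypothesis.Theorems.WeilFormatCCinfRowMonomials
import Summits.RiemannHypothesis.RiemannHypothesis.Theorems.WeilFormatCCinfMonomialAlgebra
import Summits.RiemannHypothesis.RiemannHypothesis.Theorems.WeilFormatCCinfCouplingFamilies
import HarnessLib

/-!
# Format C, design C∞ (E3, analytic side): the far rows COLLECTED by `(tag, power)` — the `hM` shape

Route context: Fourier–Galerkin / Schur-complement certificates of Weil positivity on a window ("format C", C∞ door;
cell memo `run/shared/lean/pub/rh-explicit/rh-explicit-weil-10/KERNEL-LEVER.md` §21; supporting stmt-RiemannHypothesis-0098;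
seat rh-explicit-weil-10).  `abs_evenRow/oddRow_sub_monomials_le` (`WeilFormatCCinfRowMonomials`) give the far rows
`M^±(i,m)` (`m ≥ m₀ ≥ 2i`) in FACTORED monomial form.  Distributing (`rowFactored_eq_flat`) and collecting by power
(a `private` local copy of `rowFlat_eq_collected`, whose module `WeilFormatCCinfMonomialCollect` has no hub olean at
filing time) yields the shape of the `hM` hypothesis of `coupling_majorant_gram_shifted` over the two row families
`m^{−d}` and `S_m·m^{−d}`, `d ≤ D`:

* `abs_evenRow_sub_collected_le` — `|M⁺(i,m) − (−1)^m (Σ_{d≤D} P⁺₁(i,d)/m^d + S_m Σ_{d≤D} P⁺_S(i,d)/m^d)| ≤ ρ⁺(i,m₀)(m₀/m)^{E+1}`,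
* `abs_oddRow_sub_collected_le` — the odd twin,

where every coefficient `P(i,d)` is a finite sum, over the index combinations of total power `d`, of the printed
monomial coefficients (rationals × powers of `i`, `a`, `π` × node moments `D_s(a)` × the block constants `F_i`,
`c_i`/`d_i`) — exactly what the C∞ generator tabulates (with boxes) per block row.  Conditions on `D`:
`K + 2J ≤ D + 1`, `2R + 2J ≤ D + 2` (even); `K + 2J ≤ D`, `2R + 2J ≤ D + 1` (odd).  Pure algebra over the
landed files; family forms `abs_evenRow/oddRow_sub_family_le` over `Fin 4 × Fin (D+1)` (`twoGroups_eq_sum_fin`);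
standard axioms; no definitions; no RH claim.
-/

set_option autoImplicit false
-- `Summit.RiemannHypothesis.RiemannHypothesis.…` is the layout-mandated namespace (summit = problem name).
set_option linter.dupNamespace false

noncomputable section

open Complex Filter Set MeasureTheory
open scoped Real Topology ArithmeticFunction.vonMangoldt

namespace Summit.RiemannHypothesis.RiemannHypothesis.Theorems.WeilFormatC

open Literature.NumberTheory.LFunctions Literature.NumberTheory.LFunctions.Yoshida1992
  Literature.Analysis.SpecialFunctions

variable {a : ℝ}

/-! ## Collection of the distributed row bracket (local copy) -/

/-- Local copy (the landed `rowFlat_eq_collected` of `WeilFormatCCinfMonomialCollect`, p387107, has no hub olean yet):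
collecting the four pure groups and the `S`-group of a distributed row bracket (all powers `≤ D`). -/
private theorem rowFlat_eq_collected_loc (m S B₀ : ℝ) {J Kx R D : ℕ} (g h : ℕ → ℝ) (e eh : ℕ → ℕ) (s₀ : ℝ) (sN d' : ℕ → ℝ)
    (he : ∀ j ∈ Finset.range J, e j ≤ D) (hNe : ∀ p ∈ Finset.Icc 1 Kx ×ˢ Finset.range J, p.1 + e p.2 ≤ D)
    (hre : ∀ p ∈ Finset.range R ×ˢ Finset.range J, (2 * p.1 + 1) + e p.2 ≤ D)
    (heh : ∀ r ∈ Finset.range J, eh r ≤ D) (hB : B₀ = ∑ r ∈ Finset.range J, h r / m ^ (eh r)) :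
    (∑ j ∈ Finset.range J, (s₀ * g j / Real.pi) / m ^ (e j)
        + ∑ j ∈ Finset.range J, ∑ N ∈ Finset.Icc 1 Kx, (sN N * g j / Real.pi) / m ^ (N + e j)
        - ∑ j ∈ Finset.range J, ∑ r ∈ Finset.range R, (d' r * g j / Real.pi) / m ^ ((2 * r + 1) + e j))
      + S * ∑ j ∈ Finset.range J, (g j / Real.pi) / m ^ (e j) + B₀
      = ∑ d ∈ Finset.range (D + 1),
          ((∑ j ∈ (Finset.range J).filter (fun j ↦ e j = d), s₀ * g j / Real.pi)
            + (∑ p ∈ (Finset.Icc 1 Kx ×ˢ Finset.range J).filter (fun p ↦ p.1 + e p.2 = d),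
                sN p.1 * g p.2 / Real.pi)
            - (∑ p ∈ (Finset.range R ×ˢ Finset.range J).filter (fun p ↦ (2 * p.1 + 1) + e p.2 = d),
                d' p.1 * g p.2 / Real.pi)
            + (∑ r ∈ (Finset.range J).filter (fun r ↦ eh r = d), h r)) / m ^ d
        + S * ∑ d ∈ Finset.range (D + 1), (∑ j ∈ (Finset.range J).filter (fun j ↦ e j = d), g j / Real.pi) / m ^ d := by
  rw [hB, sum_div_pow_eq_sum_fiber _ (fun j ↦ s₀ * g j / Real.pi) e he,
    sum_div_pow_eq_sum_fiber _ (fun j ↦ g j / Real.pi) e he,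
    sum_div_pow_eq_sum_fiber _ h eh heh,
    Finset.sum_comm (s := Finset.range J) (t := Finset.Icc 1 Kx),
    sum_sum_div_pow_eq_sum_product _ _ (fun N j ↦ sN N * g j / Real.pi) (fun N j ↦ N + e j),
    sum_div_pow_eq_sum_fiber _ (fun p : ℕ × ℕ ↦ sN p.1 * g p.2 / Real.pi) (fun p ↦ p.1 + e p.2) hNe,
    Finset.sum_comm (s := Finset.range J) (t := Finset.range R),
    sum_sum_div_pow_eq_sum_product _ _ (fun r j ↦ d' r * g j / Real.pi) (fun r j ↦ (2 * r + 1) + e j),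
    sum_div_pow_eq_sum_fiber _ (fun p : ℕ × ℕ ↦ d' p.1 * g p.2 / Real.pi) (fun p ↦ (2 * p.1 + 1) + e p.2) hre]
  simp only [add_div, sub_div, Finset.sum_add_distrib, Finset.sum_sub_distrib]
  ring

/-! ## The even rows collected -/

/-- **The far even rows collected by power** (`a > 0`; `m ≥ m₀ ≥ 2i`, `πm₀/a ≥ 2`; `ν ≥ 1`, `2ν ≤ K`;
`E + 1 ≤ 2ν`, `E ≤ K`, `E ≤ 2R`, `E ≤ 2J`; collection depth `D` large enough):
`M⁺(i,m) = (−1)^m (Σ_{d≤D} P⁺₁(i,d)/m^d + S_m·Σ_{d≤D} P⁺_S(i,d)/m^d) ± ρ⁺(i,m₀)·(m₀/m)^{E+1}`. -/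
theorem abs_evenRow_sub_collected_le (ha : 0 < a) {m₀ m : ℕ} (hm₀ : 2 ≤ π * m₀ / a) (hmm : m₀ ≤ m) {i : ℕ}
    (him : 2 * i ≤ m₀) {ν : ℕ} (hν : ν ≠ 0) {K : ℕ} (hK : 2 * ν ≤ K) {R J : ℕ} {E : ℕ} (hE1 : E + 1 ≤ 2 * ν)
    (hE2 : E ≤ K) (hE3 : E ≤ 2 * R) (hEJ : E ≤ 2 * J) {D : ℕ} (hD1 : K + 2 * J ≤ D + 1) (hD2 : 2 * R + 2 * J ≤ D + 2) :
    |(if i = 0 then gramCoeff a 0 m else if m = 0 then gramCoeff a i 0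
        else (gramCoeff a i m + gramCoeff a i (-(m : ℤ))) / 2)
      - (-1 : ℝ) ^ m *
        (∑ d ∈ Finset.range (D + 1),
            ((∑ j ∈ (Finset.range J).filter (fun j ↦ (2 * j + 1) = d),
                π / 4 * ((-1 : ℝ) ^ i * (i : ℝ) ^ (2 * j)) / Real.pi)
              + (∑ p ∈ (Finset.Icc 1 K ×ˢ Finset.range J).filter (fun p ↦ p.1 + (2 * p.2 + 1) = d),
                  (fun N : ℕ ↦ (if N % 4 = 1 then (1 : ℝ) else if N % 4 = 3 then -1 else 0)
              * (1 - 1 / (2 * (N : ℝ))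
                  - (∑ l ∈ Finset.Icc 1 ν, (bernoulli (2 * l) : ℝ) / (2 * l) * 16 ^ l
                      * (((N - 1).choose (2 * l - 1) : ℕ) : ℝ)) / 2)
              * (a / (2 * π)) ^ N) p.1
                    * ((-1 : ℝ) ^ i * (i : ℝ) ^ (2 * p.2)) / Real.pi)
              - (∑ p ∈ (Finset.range R ×ˢ Finset.range J).filter (fun p ↦ (2 * p.1 + 1) + (2 * p.2 + 1) = d),
                  (fun r : ℕ ↦ (-1 : ℝ) ^ r *
              (∑' l : ℕ, Real.exp (-(2 * a * digammaNode l)) * digammaNode l ^ (2 * r)) * (a / π) ^ (2 * r + 1)) p.1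
                    * ((-1 : ℝ) ^ i * (i : ℝ) ^ (2 * p.2)) / Real.pi)
              + (∑ r ∈ (Finset.range J).filter (fun r ↦ (2 * r + 2) = d),
                  (fun r : ℕ ↦ (-1 : ℝ) ^ i *
              (-((i : ℝ) ^ (2 * r + 1)) * ((Complex.digamma (1 / 4 + ((freq a i : ℝ) : ℂ) / 2 * I)).im / 2
                  + (∑ k ∈ weilPrimeIndex a, (Λ k : ℝ) / Real.sqrt k * Real.sin (freq a i * Real.log k))
                  - archExpSumSin a i) / π
                + 4 / a * (Real.exp (a / 2) - Real.exp (-(a / 2))) ^ 2 * (-1 : ℝ) ^ r * (a ^ 2 / (4 * π ^ 2)) ^ (r + 1)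
                  * (1 / (1 + 4 * freq a i ^ 2)))) r)) / (m : ℝ) ^ d
          + (∑ n ∈ weilPrimeIndex a, (Λ n : ℝ) / Real.sqrt n * Real.sin (π * m / a * Real.log n))
            * ∑ d ∈ Finset.range (D + 1), (∑ j ∈ (Finset.range J).filter (fun j ↦ (2 * j + 1) = d),
                ((-1 : ℝ) ^ i * (i : ℝ) ^ (2 * j)) / Real.pi) / (m : ℝ) ^ d)|
      ≤ (((4 * Real.pi ^ 2 / 3 * ((2 * ν + 1).factorial : ℝ) / (2 * Real.pi) ^ (2 * ν + 1)
                * (4 * (1 / (4 * (π * m₀ / a / 2)))) ^ (2 * ν)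
              + (1 / (4 * (π * m₀ / a / 2))) ^ (K + 1) / ((K + 1) * (1 - 1 / (4 * (π * m₀ / a / 2))))
              + 2 * (1 / (4 * (π * m₀ / a / 2))) ^ (K + 1)
              + ∑ k ∈ Finset.Icc 1 ν, |(bernoulli (2 * k) : ℝ) / (2 * k)| * 2 ^ (K + 1 + 4 * k)
                  * (1 / (4 * (π * m₀ / a / 2))) ^ (K + 1)) / 2
            + (∑' k : ℕ, Real.exp (-(2 * a * digammaNode k)) * digammaNode k ^ (2 * R))
                / |π * m₀ / a| ^ (2 * R + 1)) / π
            * ∑ j ∈ Finset.range J, (i : ℝ) ^ (2 * j) / (m₀ : ℝ) ^ (2 * j + 1)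
          + (2 * (π / 4 + (∑ k ∈ weilPrimeIndex a, (Λ k : ℝ) / Real.sqrt k) + a * (1 + weilArchDensity (2 * a)) / π)
                * (i : ℝ) ^ (2 * J) / π
              + 4 / a * (Real.exp (a / 2) - Real.exp (-(a / 2))) ^ 2 * (a ^ 2 / (4 * π ^ 2)) ^ (J + 1)
                * (1 / (1 + 4 * freq a i ^ 2))) / (m₀ : ℝ) ^ (2 * J + 1))
        * ((m₀ : ℝ) / m) ^ (E + 1) := by
  have h := abs_evenRow_sub_monomials_le ha hm₀ hmm him hν hK R J hE1 hE2 hE3 hEJ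
  have eflat := rowFactored_eq_flat (m : ℝ) (π / 4) (∑ n ∈ weilPrimeIndex a, (Λ n : ℝ) / Real.sqrt n * Real.sin (π * m / a * Real.log n))
    (∑ r ∈ Finset.range J, (fun r : ℕ ↦ (-1 : ℝ) ^ i *
              (-((i : ℝ) ^ (2 * r + 1)) * ((Complex.digamma (1 / 4 + ((freq a i : ℝ) : ℂ) / 2 * I)).im / 2
                  + (∑ k ∈ weilPrimeIndex a, (Λ k : ℝ) / Real.sqrt k * Real.sin (freq a i * Real.log k))
                  - archExpSumSin a i) / π
                + 4 / a * (Real.exp (a / 2) - Real.exp (-(a / 2))) ^ 2 * (-1 : ℝ) ^ r * (a ^ 2 / (4 * π ^ 2)) ^ (r + 1)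
                  * (1 / (1 + 4 * freq a i ^ 2)))) r / (m : ℝ) ^ (2 * r + 2)) J K R
    (fun j ↦ (-1 : ℝ) ^ i * (i : ℝ) ^ (2 * j)) (fun j ↦ (2 * j + 1)) (fun N : ℕ ↦ (if N % 4 = 1 then (1 : ℝ) else if N % 4 = 3 then -1 else 0)
              * (1 - 1 / (2 * (N : ℝ))
                  - (∑ l ∈ Finset.Icc 1 ν, (bernoulli (2 * l) : ℝ) / (2 * l) * 16 ^ l
                      * (((N - 1).choose (2 * l - 1) : ℕ) : ℝ)) / 2)
              * (a / (2 * π)) ^ N) (fun r : ℕ ↦ (-1 : ℝ) ^ r *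
              (∑' l : ℕ, Real.exp (-(2 * a * digammaNode l)) * digammaNode l ^ (2 * r)) * (a / π) ^ (2 * r + 1))
  beta_reduce at eflat
  have ecoll := rowFlat_eq_collected_loc (m : ℝ) (∑ n ∈ weilPrimeIndex a, (Λ n : ℝ) / Real.sqrt n * Real.sin (π * m / a * Real.log n))
    (∑ r ∈ Finset.range J, (fun r : ℕ ↦ (-1 : ℝ) ^ i *
              (-((i : ℝ) ^ (2 * r + 1)) * ((Complex.digamma (1 / 4 + ((freq a i : ℝ) : ℂ) / 2 * I)).im / 2
                  + (∑ k ∈ weilPrimeIndex a, (Λ k : ℝ) / Real.sqrt k * Real.sin (freq a i * Real.log k))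
                  - archExpSumSin a i) / π
                + 4 / a * (Real.exp (a / 2) - Real.exp (-(a / 2))) ^ 2 * (-1 : ℝ) ^ r * (a ^ 2 / (4 * π ^ 2)) ^ (r + 1)
                  * (1 / (1 + 4 * freq a i ^ 2)))) r / (m : ℝ) ^ (2 * r + 2)) (J := J) (Kx := K) (R := R) (D := D)
    (fun j ↦ (-1 : ℝ) ^ i * (i : ℝ) ^ (2 * j)) (fun r : ℕ ↦ (-1 : ℝ) ^ i *
              (-((i : ℝ) ^ (2 * r + 1)) * ((Complex.digamma (1 / 4 + ((freq a i : ℝ) : ℂ) / 2 * I)).im / 2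
                  + (∑ k ∈ weilPrimeIndex a, (Λ k : ℝ) / Real.sqrt k * Real.sin (freq a i * Real.log k))
                  - archExpSumSin a i) / π
                + 4 / a * (Real.exp (a / 2) - Real.exp (-(a / 2))) ^ 2 * (-1 : ℝ) ^ r * (a ^ 2 / (4 * π ^ 2)) ^ (r + 1)
                  * (1 / (1 + 4 * freq a i ^ 2)))) (fun j ↦ (2 * j + 1)) (fun r ↦ (2 * r + 2)) (π / 4) (fun N : ℕ ↦ (if N % 4 = 1 then (1 : ℝ) else if N % 4 = 3 then -1 else 0)
              * (1 - 1 / (2 * (N : ℝ))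
                  - (∑ l ∈ Finset.Icc 1 ν, (bernoulli (2 * l) : ℝ) / (2 * l) * 16 ^ l
                      * (((N - 1).choose (2 * l - 1) : ℕ) : ℝ)) / 2)
              * (a / (2 * π)) ^ N) (fun r : ℕ ↦ (-1 : ℝ) ^ r *
              (∑' l : ℕ, Real.exp (-(2 * a * digammaNode l)) * digammaNode l ^ (2 * r)) * (a / π) ^ (2 * r + 1))
    (fun j hj ↦ by have := Finset.mem_range.1 hj; omega)
    (fun p hp ↦ by
      have h1 := (Finset.mem_Icc.1 (Finset.mem_product.1 hp).1).2
      have h2 := Finset.mem_range.1 (Finset.mem_product.1 hp).2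
      omega)
    (fun p hp ↦ by
      have h1 := Finset.mem_range.1 (Finset.mem_product.1 hp).1
      have h2 := Finset.mem_range.1 (Finset.mem_product.1 hp).2
      omega)
    (fun r hr ↦ by have := Finset.mem_range.1 hr; omega) rfl
  beta_reduce at ecoll
  rw [eflat, ecoll] at h
  exact h

/-! ## The odd rows collected -/

/-- **The far odd rows collected by power** (`a > 0`; `m ≥ m₀ ≥ 2i`, `i ≥ 1`, `πm₀/a ≥ 2`; `ν ≥ 1`, `2ν ≤ K`;
`E + 1 ≤ 2ν`, `E ≤ K`, `E ≤ 2R`, `E ≤ 2J`; collection depth `D` large enough):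
`M⁻(i,m) = (−1)^m (Σ_{d≤D} P⁻₁(i,d)/m^d + S_m·Σ_{d≤D} P⁻_S(i,d)/m^d) ± ρ⁻(i,m₀)·(m₀/m)^{E+1}`. -/
theorem abs_oddRow_sub_collected_le (ha : 0 < a) {m₀ m : ℕ} (hm₀ : 2 ≤ π * m₀ / a) (hmm : m₀ ≤ m) {i : ℕ}
    (hi : 1 ≤ i) (him : 2 * i ≤ m₀) {ν : ℕ} (hν : ν ≠ 0) {K : ℕ} (hK : 2 * ν ≤ K) {R J : ℕ} {E : ℕ} (hE1 : E + 1 ≤ 2 * ν)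
    (hE2 : E ≤ K) (hE3 : E ≤ 2 * R) (hEJ : E ≤ 2 * J) {D : ℕ} (hD1 : K + 2 * J ≤ D) (hD2 : 2 * R + 2 * J ≤ D + 1) :
    |(gramCoeff a i m - gramCoeff a i (-(m : ℤ))) / 2
      - (-1 : ℝ) ^ m *
        (∑ d ∈ Finset.range (D + 1),
            ((∑ j ∈ (Finset.range J).filter (fun j ↦ (2 * j + 2) = d),
                π / 4 * ((-1 : ℝ) ^ i * (i : ℝ) ^ (2 * j + 1)) / Real.pi)
              + (∑ p ∈ (Finset.Icc 1 K ×ˢ Finset.range J).filter (fun p ↦ p.1 + (2 * p.2 + 2) = d),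
                  (fun N : ℕ ↦ (if N % 4 = 1 then (1 : ℝ) else if N % 4 = 3 then -1 else 0)
              * (1 - 1 / (2 * (N : ℝ))
                  - (∑ l ∈ Finset.Icc 1 ν, (bernoulli (2 * l) : ℝ) / (2 * l) * 16 ^ l
                      * (((N - 1).choose (2 * l - 1) : ℕ) : ℝ)) / 2)
              * (a / (2 * π)) ^ N) p.1
                    * ((-1 : ℝ) ^ i * (i : ℝ) ^ (2 * p.2 + 1)) / Real.pi)
              - (∑ p ∈ (Finset.range R ×ˢ Finset.range J).filter (fun p ↦ (2 * p.1 + 1) + (2 * p.2 + 2) = d),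
                  (fun r : ℕ ↦ (-1 : ℝ) ^ r *
              (∑' l : ℕ, Real.exp (-(2 * a * digammaNode l)) * digammaNode l ^ (2 * r)) * (a / π) ^ (2 * r + 1)) p.1
                    * ((-1 : ℝ) ^ i * (i : ℝ) ^ (2 * p.2 + 1)) / Real.pi)
              + (∑ r ∈ (Finset.range J).filter (fun r ↦ (2 * r + 1) = d),
                  (fun r : ℕ ↦ (-1 : ℝ) ^ i *
              (-((i : ℝ) ^ (2 * r)) * ((Complex.digamma (1 / 4 + ((freq a i : ℝ) : ℂ) / 2 * I)).im / 2
                  + (∑ k ∈ weilPrimeIndex a, (Λ k : ℝ) / Real.sqrt k * Real.sin (freq a i * Real.log k))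
                  - archExpSumSin a i) / π
                - 4 * (Real.exp (a / 2) - Real.exp (-(a / 2))) ^ 2 / π * (-1 : ℝ) ^ r * (a ^ 2 / (4 * π ^ 2)) ^ r
                  * (freq a i / (1 + 4 * freq a i ^ 2)))) r)) / (m : ℝ) ^ d
          + (∑ n ∈ weilPrimeIndex a, (Λ n : ℝ) / Real.sqrt n * Real.sin (π * m / a * Real.log n))
            * ∑ d ∈ Finset.range (D + 1), (∑ j ∈ (Finset.range J).filter (fun j ↦ (2 * j + 2) = d),
                ((-1 : ℝ) ^ i * (i : ℝ) ^ (2 * j + 1)) / Real.pi) / (m : ℝ) ^ d)|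
      ≤ (((4 * Real.pi ^ 2 / 3 * ((2 * ν + 1).factorial : ℝ) / (2 * Real.pi) ^ (2 * ν + 1)
                * (4 * (1 / (4 * (π * m₀ / a / 2)))) ^ (2 * ν)
              + (1 / (4 * (π * m₀ / a / 2))) ^ (K + 1) / ((K + 1) * (1 - 1 / (4 * (π * m₀ / a / 2))))
              + 2 * (1 / (4 * (π * m₀ / a / 2))) ^ (K + 1)
              + ∑ k ∈ Finset.Icc 1 ν, |(bernoulli (2 * k) : ℝ) / (2 * k)| * 2 ^ (K + 1 + 4 * k)
                  * (1 / (4 * (π * m₀ / a / 2))) ^ (K + 1)) / 2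
            + (∑' k : ℕ, Real.exp (-(2 * a * digammaNode k)) * digammaNode k ^ (2 * R))
                / |π * m₀ / a| ^ (2 * R + 1)) / π
            * ∑ j ∈ Finset.range J, (i : ℝ) ^ (2 * j + 1) / (m₀ : ℝ) ^ (2 * j + 2)
          + (2 * (π / 4 + (∑ k ∈ weilPrimeIndex a, (Λ k : ℝ) / Real.sqrt k) + a * (1 + weilArchDensity (2 * a)) / π)
                * (i : ℝ) ^ (2 * J) / π
              + 4 * (Real.exp (a / 2) - Real.exp (-(a / 2))) ^ 2 / π * (a ^ 2 / (4 * π ^ 2)) ^ J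
                * (freq a i / (1 + 4 * freq a i ^ 2))) / (m₀ : ℝ) ^ (2 * J + 1))
        * ((m₀ : ℝ) / m) ^ (E + 1) := by
  have h := abs_oddRow_sub_monomials_le ha hm₀ hmm hi him hν hK R J hE1 hE2 hE3 hEJ
  have eflat := rowFactored_eq_flat (m : ℝ) (π / 4) (∑ n ∈ weilPrimeIndex a, (Λ n : ℝ) / Real.sqrt n * Real.sin (π * m / a * Real.log n))
    (∑ r ∈ Finset.range J, (fun r : ℕ ↦ (-1 : ℝ) ^ i *
              (-((i : ℝ) ^ (2 * r)) * ((Complex.digamma (1 / 4 + ((freq a i : ℝ) : ℂ) / 2 * I)).im / 2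
                  + (∑ k ∈ weilPrimeIndex a, (Λ k : ℝ) / Real.sqrt k * Real.sin (freq a i * Real.log k))
                  - archExpSumSin a i) / π
                - 4 * (Real.exp (a / 2) - Real.exp (-(a / 2))) ^ 2 / π * (-1 : ℝ) ^ r * (a ^ 2 / (4 * π ^ 2)) ^ r
                  * (freq a i / (1 + 4 * freq a i ^ 2)))) r / (m : ℝ) ^ (2 * r + 1)) J K R
    (fun j ↦ (-1 : ℝ) ^ i * (i : ℝ) ^ (2 * j + 1)) (fun j ↦ (2 * j + 2)) (fun N : ℕ ↦ (if N % 4 = 1 then (1 : ℝ) else if N % 4 = 3 then -1 else 0)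
              * (1 - 1 / (2 * (N : ℝ))
                  - (∑ l ∈ Finset.Icc 1 ν, (bernoulli (2 * l) : ℝ) / (2 * l) * 16 ^ l
                      * (((N - 1).choose (2 * l - 1) : ℕ) : ℝ)) / 2)
              * (a / (2 * π)) ^ N) (fun r : ℕ ↦ (-1 : ℝ) ^ r *
              (∑' l : ℕ, Real.exp (-(2 * a * digammaNode l)) * digammaNode l ^ (2 * r)) * (a / π) ^ (2 * r + 1))
  beta_reduce at eflat
  have ecoll := rowFlat_eq_collected_loc (m : ℝ) (∑ n ∈ weilPrimeIndex a, (Λ n : ℝ) / Real.sqrt n * Real.sin (π * m / a * Real.log n))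
    (∑ r ∈ Finset.range J, (fun r : ℕ ↦ (-1 : ℝ) ^ i *
              (-((i : ℝ) ^ (2 * r)) * ((Complex.digamma (1 / 4 + ((freq a i : ℝ) : ℂ) / 2 * I)).im / 2
                  + (∑ k ∈ weilPrimeIndex a, (Λ k : ℝ) / Real.sqrt k * Real.sin (freq a i * Real.log k))
                  - archExpSumSin a i) / π
                - 4 * (Real.exp (a / 2) - Real.exp (-(a / 2))) ^ 2 / π * (-1 : ℝ) ^ r * (a ^ 2 / (4 * π ^ 2)) ^ r
                  * (freq a i / (1 + 4 * freq a i ^ 2)))) r / (m : ℝ) ^ (2 * r + 1)) (J := J) (Kx := K) (R := R) (D := D)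
    (fun j ↦ (-1 : ℝ) ^ i * (i : ℝ) ^ (2 * j + 1)) (fun r : ℕ ↦ (-1 : ℝ) ^ i *
              (-((i : ℝ) ^ (2 * r)) * ((Complex.digamma (1 / 4 + ((freq a i : ℝ) : ℂ) / 2 * I)).im / 2
                  + (∑ k ∈ weilPrimeIndex a, (Λ k : ℝ) / Real.sqrt k * Real.sin (freq a i * Real.log k))
                  - archExpSumSin a i) / π
                - 4 * (Real.exp (a / 2) - Real.exp (-(a / 2))) ^ 2 / π * (-1 : ℝ) ^ r * (a ^ 2 / (4 * π ^ 2)) ^ r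
                  * (freq a i / (1 + 4 * freq a i ^ 2)))) (fun j ↦ (2 * j + 2)) (fun r ↦ (2 * r + 1)) (π / 4) (fun N : ℕ ↦ (if N % 4 = 1 then (1 : ℝ) else if N % 4 = 3 then -1 else 0)
              * (1 - 1 / (2 * (N : ℝ))
                  - (∑ l ∈ Finset.Icc 1 ν, (bernoulli (2 * l) : ℝ) / (2 * l) * 16 ^ l
                      * (((N - 1).choose (2 * l - 1) : ℕ) : ℝ)) / 2)
              * (a / (2 * π)) ^ N) (fun r : ℕ ↦ (-1 : ℝ) ^ r *
              (∑' l : ℕ, Real.exp (-(2 * a * digammaNode l)) * digammaNode l ^ (2 * r)) * (a / π) ^ (2 * r + 1))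
    (fun j hj ↦ by have := Finset.mem_range.1 hj; omega)
    (fun p hp ↦ by
      have h1 := (Finset.mem_Icc.1 (Finset.mem_product.1 hp).1).2
      have h2 := Finset.mem_range.1 (Finset.mem_product.1 hp).2
      omega)
    (fun p hp ↦ by
      have h1 := Finset.mem_range.1 (Finset.mem_product.1 hp).1
      have h2 := Finset.mem_range.1 (Finset.mem_product.1 hp).2
      omega)
    (fun r hr ↦ by have := Finset.mem_range.1 hr; omega) rfl
  beta_reduce at ecoll
  rw [eflat, ecoll] at h
  exact h

/-! ## Family forms (one sum over `Fin 4 × Fin (D+1)`) -/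

/-- **Family form** of `abs_evenRow_sub_collected_le`: the same bound with the collected groups written as ONE family sum over
`Fin 4 × Fin (D+1)` (`twoGroups_eq_sum_fin`; tags `1, log m, −C_m, S_m`), i.e. literally the `hrow` shape of
`cinf_hUq_even/odd` with `φ_{(t,d)}(m) = (1, log m, −C_m, S_m)_t/m^d`. -/
theorem abs_evenRow_sub_family_le (ha : 0 < a) {m₀ m : ℕ} (hm₀ : 2 ≤ π * m₀ / a) (hmm : m₀ ≤ m) {i : ℕ}
    (him : 2 * i ≤ m₀) {ν : ℕ} (hν : ν ≠ 0) {K : ℕ} (hK : 2 * ν ≤ K) {R J : ℕ} {E : ℕ} (hE1 : E + 1 ≤ 2 * ν)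
    (hE2 : E ≤ K) (hE3 : E ≤ 2 * R) (hEJ : E ≤ 2 * J) {D : ℕ} (hD1 : K + 2 * J ≤ D + 1) (hD2 : 2 * R + 2 * J ≤ D + 2) :
    |(if i = 0 then gramCoeff a 0 m else if m = 0 then gramCoeff a i 0
        else (gramCoeff a i m + gramCoeff a i (-(m : ℤ))) / 2)
      - (-1 : ℝ) ^ m *
        ∑ x : Fin 4 × Fin (D + 1),
            ((![fun d : ℕ ↦ (∑ j ∈ (Finset.range J).filter (fun j ↦ (2 * j + 1) = d),
                π / 4 * ((-1 : ℝ) ^ i * (i : ℝ) ^ (2 * j)) / Real.pi)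
              + (∑ p ∈ (Finset.Icc 1 K ×ˢ Finset.range J).filter (fun p ↦ p.1 + (2 * p.2 + 1) = d),
                  (fun N : ℕ ↦ (if N % 4 = 1 then (1 : ℝ) else if N % 4 = 3 then -1 else 0)
              * (1 - 1 / (2 * (N : ℝ))
                  - (∑ l ∈ Finset.Icc 1 ν, (bernoulli (2 * l) : ℝ) / (2 * l) * 16 ^ l
                      * (((N - 1).choose (2 * l - 1) : ℕ) : ℝ)) / 2)
              * (a / (2 * π)) ^ N) p.1
                    * ((-1 : ℝ) ^ i * (i : ℝ) ^ (2 * p.2)) / Real.pi)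
              - (∑ p ∈ (Finset.range R ×ˢ Finset.range J).filter (fun p ↦ (2 * p.1 + 1) + (2 * p.2 + 1) = d),
                  (fun r : ℕ ↦ (-1 : ℝ) ^ r *
              (∑' l : ℕ, Real.exp (-(2 * a * digammaNode l)) * digammaNode l ^ (2 * r)) * (a / π) ^ (2 * r + 1)) p.1
                    * ((-1 : ℝ) ^ i * (i : ℝ) ^ (2 * p.2)) / Real.pi)
              + (∑ r ∈ (Finset.range J).filter (fun r ↦ (2 * r + 2) = d),
                  (fun r : ℕ ↦ (-1 : ℝ) ^ i *
              (-((i : ℝ) ^ (2 * r + 1)) * ((Complex.digamma (1 / 4 + ((freq a i : ℝ) : ℂ) / 2 * I)).im / 2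
                  + (∑ k ∈ weilPrimeIndex a, (Λ k : ℝ) / Real.sqrt k * Real.sin (freq a i * Real.log k))
                  - archExpSumSin a i) / π
                + 4 / a * (Real.exp (a / 2) - Real.exp (-(a / 2))) ^ 2 * (-1 : ℝ) ^ r * (a ^ 2 / (4 * π ^ 2)) ^ (r + 1)
                  * (1 / (1 + 4 * freq a i ^ 2)))) r),
                fun _ ↦ 0, fun _ ↦ 0,
                fun d : ℕ ↦ ∑ j ∈ (Finset.range J).filter (fun j ↦ (2 * j + 1) = d),
                ((-1 : ℝ) ^ i * (i : ℝ) ^ (2 * j)) / Real.pi] x.1) x.2)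
              * (![(1 : ℝ), Real.log m, -(∑ n ∈ weilPrimeIndex a, (Λ n : ℝ) / Real.sqrt n * Real.cos (π * m / a * Real.log n)), (∑ n ∈ weilPrimeIndex a, (Λ n : ℝ) / Real.sqrt n * Real.sin (π * m / a * Real.log n))] x.1 / (m : ℝ) ^ (x.2 : ℕ))|
      ≤ (((4 * Real.pi ^ 2 / 3 * ((2 * ν + 1).factorial : ℝ) / (2 * Real.pi) ^ (2 * ν + 1)
                * (4 * (1 / (4 * (π * m₀ / a / 2)))) ^ (2 * ν)
              + (1 / (4 * (π * m₀ / a / 2))) ^ (K + 1) / ((K + 1) * (1 - 1 / (4 * (π * m₀ / a / 2))))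
              + 2 * (1 / (4 * (π * m₀ / a / 2))) ^ (K + 1)
              + ∑ k ∈ Finset.Icc 1 ν, |(bernoulli (2 * k) : ℝ) / (2 * k)| * 2 ^ (K + 1 + 4 * k)
                  * (1 / (4 * (π * m₀ / a / 2))) ^ (K + 1)) / 2
            + (∑' k : ℕ, Real.exp (-(2 * a * digammaNode k)) * digammaNode k ^ (2 * R))
                / |π * m₀ / a| ^ (2 * R + 1)) / π
            * ∑ j ∈ Finset.range J, (i : ℝ) ^ (2 * j) / (m₀ : ℝ) ^ (2 * j + 1)
          + (2 * (π / 4 + (∑ k ∈ weilPrimeIndex a, (Λ k : ℝ) / Real.sqrt k) + a * (1 + weilArchDensity (2 * a)) / π)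
                * (i : ℝ) ^ (2 * J) / π
              + 4 / a * (Real.exp (a / 2) - Real.exp (-(a / 2))) ^ 2 * (a ^ 2 / (4 * π ^ 2)) ^ (J + 1)
                * (1 / (1 + 4 * freq a i ^ 2))) / (m₀ : ℝ) ^ (2 * J + 1))
        * ((m₀ : ℝ) / m) ^ (E + 1) := by
  rw [← twoGroups_eq_sum_fin]
  exact abs_evenRow_sub_collected_le (ha := ha) (m₀ := m₀) (m := m) (hm₀ := hm₀) (hmm := hmm) (i := i) (him := him) (ν := ν) (hν := hν) (K := K) (hK := hK) (R := R) (J := J) (E := E) (hE1 := hE1) (hE2 := hE2) (hE3 := hE3) (hEJ := hEJ) (D := D) (hD1 := hD1) (hD2 := hD2)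

/-- **Family form** of `abs_oddRow_sub_collected_le`: the same bound with the collected groups written as ONE family sum over
`Fin 4 × Fin (D+1)` (`twoGroups_eq_sum_fin`; tags `1, log m, −C_m, S_m`), i.e. literally the `hrow` shape of
`cinf_hUq_even/odd` with `φ_{(t,d)}(m) = (1, log m, −C_m, S_m)_t/m^d`. -/
theorem abs_oddRow_sub_family_le (ha : 0 < a) {m₀ m : ℕ} (hm₀ : 2 ≤ π * m₀ / a) (hmm : m₀ ≤ m) {i : ℕ}
    (hi : 1 ≤ i) (him : 2 * i ≤ m₀) {ν : ℕ} (hν : ν ≠ 0) {K : ℕ} (hK : 2 * ν ≤ K) {R J : ℕ} {E : ℕ} (hE1 : E + 1 ≤ 2 * ν)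
    (hE2 : E ≤ K) (hE3 : E ≤ 2 * R) (hEJ : E ≤ 2 * J) {D : ℕ} (hD1 : K + 2 * J ≤ D) (hD2 : 2 * R + 2 * J ≤ D + 1) :
    |(gramCoeff a i m - gramCoeff a i (-(m : ℤ))) / 2
      - (-1 : ℝ) ^ m *
        ∑ x : Fin 4 × Fin (D + 1),
            ((![fun d : ℕ ↦ (∑ j ∈ (Finset.range J).filter (fun j ↦ (2 * j + 2) = d),
                π / 4 * ((-1 : ℝ) ^ i * (i : ℝ) ^ (2 * j + 1)) / Real.pi)
              + (∑ p ∈ (Finset.Icc 1 K ×ˢ Finset.range J).filter (fun p ↦ p.1 + (2 * p.2 + 2) = d),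
                  (fun N : ℕ ↦ (if N % 4 = 1 then (1 : ℝ) else if N % 4 = 3 then -1 else 0)
              * (1 - 1 / (2 * (N : ℝ))
                  - (∑ l ∈ Finset.Icc 1 ν, (bernoulli (2 * l) : ℝ) / (2 * l) * 16 ^ l
                      * (((N - 1).choose (2 * l - 1) : ℕ) : ℝ)) / 2)
              * (a / (2 * π)) ^ N) p.1
                    * ((-1 : ℝ) ^ i * (i : ℝ) ^ (2 * p.2 + 1)) / Real.pi)
              - (∑ p ∈ (Finset.range R ×ˢ Finset.range J).filter (fun p ↦ (2 * p.1 + 1) + (2 * p.2 + 2) = d),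
                  (fun r : ℕ ↦ (-1 : ℝ) ^ r *
              (∑' l : ℕ, Real.exp (-(2 * a * digammaNode l)) * digammaNode l ^ (2 * r)) * (a / π) ^ (2 * r + 1)) p.1
                    * ((-1 : ℝ) ^ i * (i : ℝ) ^ (2 * p.2 + 1)) / Real.pi)
              + (∑ r ∈ (Finset.range J).filter (fun r ↦ (2 * r + 1) = d),
                  (fun r : ℕ ↦ (-1 : ℝ) ^ i *
              (-((i : ℝ) ^ (2 * r)) * ((Complex.digamma (1 / 4 + ((freq a i : ℝ) : ℂ) / 2 * I)).im / 2
                  + (∑ k ∈ weilPrimeIndex a, (Λ k : ℝ) / Real.sqrt k * Real.sin (freq a i * Real.log k))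
                  - archExpSumSin a i) / π
                - 4 * (Real.exp (a / 2) - Real.exp (-(a / 2))) ^ 2 / π * (-1 : ℝ) ^ r * (a ^ 2 / (4 * π ^ 2)) ^ r
                  * (freq a i / (1 + 4 * freq a i ^ 2)))) r),
                fun _ ↦ 0, fun _ ↦ 0,
                fun d : ℕ ↦ ∑ j ∈ (Finset.range J).filter (fun j ↦ (2 * j + 2) = d),
                ((-1 : ℝ) ^ i * (i : ℝ) ^ (2 * j + 1)) / Real.pi] x.1) x.2)
              * (![(1 : ℝ), Real.log m, -(∑ n ∈ weilPrimeIndex a, (Λ n : ℝ) / Real.sqrt n * Real.cos (π * m / a * Real.log n)), (∑ n ∈ weilPrimeIndex a, (Λ n : ℝ) / Real.sqrt n * Real.sin (π * m / a * Real.log n))] x.1 / (m : ℝ) ^ (x.2 : ℕ))|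
      ≤ (((4 * Real.pi ^ 2 / 3 * ((2 * ν + 1).factorial : ℝ) / (2 * Real.pi) ^ (2 * ν + 1)
                * (4 * (1 / (4 * (π * m₀ / a / 2)))) ^ (2 * ν)
              + (1 / (4 * (π * m₀ / a / 2))) ^ (K + 1) / ((K + 1) * (1 - 1 / (4 * (π * m₀ / a / 2))))
              + 2 * (1 / (4 * (π * m₀ / a / 2))) ^ (K + 1)
              + ∑ k ∈ Finset.Icc 1 ν, |(bernoulli (2 * k) : ℝ) / (2 * k)| * 2 ^ (K + 1 + 4 * k)
                  * (1 / (4 * (π * m₀ / a / 2))) ^ (K + 1)) / 2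
            + (∑' k : ℕ, Real.exp (-(2 * a * digammaNode k)) * digammaNode k ^ (2 * R))
                / |π * m₀ / a| ^ (2 * R + 1)) / π
            * ∑ j ∈ Finset.range J, (i : ℝ) ^ (2 * j + 1) / (m₀ : ℝ) ^ (2 * j + 2)
          + (2 * (π / 4 + (∑ k ∈ weilPrimeIndex a, (Λ k : ℝ) / Real.sqrt k) + a * (1 + weilArchDensity (2 * a)) / π)
                * (i : ℝ) ^ (2 * J) / π
              + 4 * (Real.exp (a / 2) - Real.exp (-(a / 2))) ^ 2 / π * (a ^ 2 / (4 * π ^ 2)) ^ J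
                * (freq a i / (1 + 4 * freq a i ^ 2))) / (m₀ : ℝ) ^ (2 * J + 1))
        * ((m₀ : ℝ) / m) ^ (E + 1) := by
  rw [← twoGroups_eq_sum_fin]
  exact abs_oddRow_sub_collected_le (ha := ha) (m₀ := m₀) (m := m) (hm₀ := hm₀) (hmm := hmm) (i := i) (hi := hi) (him := him) (ν := ν) (hν := hν) (K := K) (hK := hK) (R := R) (J := J) (E := E) (hE1 := hE1) (hE2 := hE2) (hE3 := hE3) (hEJ := hEJ) (D := D) (hD1 := hD1) (hD2 := hD2)

end Summit.RiemannHypothesis.RiemannHypothesis.Theorems.WeilFormatC
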